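import Literature.NumberTheory.Automorphic.AutomorphicGaloisConj
import Literature.NumberTheory.Automorphic.AutomorphicConjugate
import Literature.NumberTheory.Automorphic.ConjugateSelfDualCharacters
import HarnessLib

/-!
# ED.3 — review-class fix from the squad RETRO-AUDIT (TL-t11 g2, 2026-09-02T03:30Z, rule L1 «exact relation») + INDEX repair

(1) `Def12NoteAsPrinted`: print says «Note that **(2)** implies that the cuspidal factors `Π_1, …, Π_{s(Π)}` in (1) are mutually
non-isomorphic» (p. 6 L9; l. 685).  ED.1/ED.2 took the whole of `IsRelevant` (= Def. 1.2 (1) ∧ (2)) as hypothesis, which is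
logically WEAKER than print by the unused conjunct (1) «`Π_i ∘ c ≃ Π_i^∨`» (the printed reason is the archimedean one: the
exponents `1−n, 3−n, …, n−1` are pairwise distinct).  ED.3 states it with hypothesis `Def12Clause2 X P` exactly, and drops the
binders `F`, `hμ`, `c` that only clause (1) used.  (2) Module-docstring INDEX: the row «Theorem 1.8» was truncated in ED.1 — it now
reads «↦ ★ `L.Sec53OrbitalDecomposition.Thm525`» — a duplicated fragment line under «§1.3» is removed, and the rows that cited sibling
files as «(TL-t0k, HOME)» now cite them as ★ (all landed: §4.3 p847958, §4.4 p847895, §5.1 p848033, §5.2 p848126/p848267, §5.3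
p848357).  Every other declaration is byte-identical to ED.2 (p848237); 0 importers.

STATUS SINCE 2026-09-02T03:33Z (squad ruling TL-plan g2-3 (1) on T-ref4 QA-20, superseding the ED.2 note below): for the RELATIVE side
of [Liu2021] §1.2–§1.4 (`S_n`, `M_n`, regular semisimple pairs, transfer factor, actions, sign, matching, orbital integrals, items
1.9 / 1.10 / 1.12 / 1.13 / 1.14) and for item 1.15 the CANONICAL names are this seat's REAL typing — ★ `Sec13RelativeFundamentalLemma`,
★ `Sec13ArithmeticFundamentalLemma`, and this file's `Item115Dictionary` / `IsHermSpace` / `Item115AsPrinted` / `Footnote3AsPrinted`;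
★ `Sec13to16IntroductionAFL` stays canonical for `Sec14Data` / `Sec15Data` and the RZ-side tokens, its overlapping declarations being
kept for their importers but superseded; NEW files cite this seat's names for those objects, existing consumers migrate at their
next substantive edition.  The ED.2 correspondence below is kept as the dictionary between the two typings.
-/

/-!
# ED.2 — note on the two typings of item 1.15 / footnote 3 and of §1.3–§1.6 (status superseded by the ED.3 note above)

ED.2 text (2026-09-02T02:45Z), kept for the record — its «OF RECORD» / «NOT of record» attributions are REVERSED for the relative side
and item 1.15 by ruling g2-3 (1), see above: «For [Liu2021] §1.3–§1.6 (items 1.9–1.15, Remarks 1.10, 1.13, 1.14, §1.5) the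
vocabulary of record is ★ `Literature/NumberTheory/Automorphic/Liu2021/Sec13to16IntroductionAFL.lean` (squad TL typer TL-t02, p847973,
landed 2026-09-02T02:26Z): `Sec13Data.*` (§1.3), `Sec14Data.Item115AsPrinted` / `Sec14Data.Footnote115` (item 1.15 and footnote 3),
`Sec15Data.lFunction_eq` (§1.5).»  This file's `Item115Dictionary` / `IsHermSpace` / `Item115AsPrinted` / `Footnote3AsPrinted` and that
file's `Sec14Data.Item115AsPrinted` / `Sec14Data.Footnote115` type the same two printed sentences (here over the CM-field instance
`IsCMField E` and hermitian Gram matrices in coordinates, there over `Thm418Data`-style instance arguments for `E/F`).  Likewise the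
two §1.3 files of this seat named below (`Sec13RelativeFundamentalLemma`, `Sec13ArithmeticFundamentalLemma`) and `Sec13Data` type the
same pages; the correspondence for §1.3–§1.5 reads: §1.3 set-up ↦ `Sec13Data` (`Sn`, `Mn`, `IsRS`, `transferFactor`, `act`, `IsPlus`/`IsMinus`, `IsRSU`, `Matches`,
`MatchingBijectionAsPrinted`, `OrbInvariantAsPrinted`); item 1.9 ↦ `Sec13Data.Stmt19_1` / `Stmt19_2` / `Item19AsPrinted`; Rem. 1.10 ↦
`Sec13Data.Rem110_2`; Def. 1.11 ↦ field `Sec13Data.specialDivisor`; item 1.12 ↦ `Sec13Data.Item112AsPrinted`, `AFLLeftOrbitInvariant`;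
Rem. 1.13 ↦ `Sec13Data.Rem113_equiv` / `Rem113_1` / `Rem113_2`; Rem. 1.14 ↦ `Sec13Data.Rem114` (and ★ `AppendixA/AFLMinusculeCase.lean`);
item 1.15 ↦ `Sec14Data.Item115AsPrinted`; footnote 3 ↦ `Sec14Data.Footnote115`; §1.5 (p. 18 L9–11, «`L(s, σ₁ × σ₂ × σ₃) = L(s, Π₁ ×
Π₂ ⊗ μ)`») ↦ `Sec15Data.lFunction_eq` (the §1.5 token has no counterpart in this seat's files and stays canonical there).  Definition
1.2 (`IsobaricSum`, `IsRelevant`, …), the rest of the INDEX and the §1.7 conventions below are unaffected.  ED.2 statements were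
byte-identical to ED.1 (p848154); that edition changed the module docstring only.
-/

/-!
# Liu 2021, §1 «Introduction» (print pp. 3–21) — SECTION CARPET, file 1 of 3: the INDEX of every item of §1, Definition 1.2
# (relevant representations of `GL_n(𝔸_E)`) and item 1.15 with its footnote 3 — STATEMENTS AS PRINTED (named-fact PREDICATES
# `def … : Prop` over REAL tree objects + ⟨CARRIER⟩ data; NO proof of anything; the introduction's restatements of §4–§5 results
# are INDEXED to their tree declarations, not re-typed).  The purely local §1.3 (arithmetic fundamental lemma for `U(n) × U(n)`)
# is typed in the two sibling files `Sec13RelativeFundamentalLemma.lean` (set-up, item 1.9, Remark 1.10) and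
# `Sec13ArithmeticFundamentalLemma.lean` (relative Rapoport–Zink dictionary, Definition 1.11, item 1.12, Remarks 1.13–1.14) of the
# same seat (squad TL «GO 500», typer TL-t11; the split keeps each byte-set within the statement-only lane).

[Liu2021] = Yifeng Liu, *Fourier–Jacobi cycles and arithmetic relative trace formula* (with an appendix by Chao Li and
Yihang Zhu), Cambridge J. Math. **9** (2021), no. 1, 1–147 = arXiv:2102.11518.  PRIMARY SOURCE READ FOR THIS FILE: the
PRINT text held as `paper:liu2021-fourier-jacobi-cycles-arithmetic-relative-trace-formula` (147 pp.; page file `pNNNN` =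
journal page `N`; every «p. N Lk» below is line `k` of that page file), cross-checked against the author's TeX source of
record `FJcycle.tex` (md5 `6db49a74122d…`; every «l. NNNN» below is a line of that file).  §1 = TeX l. 621–1158:
§1.1 l. 625 (p. 3), Thm. 1.1 l. 652 (p. 5 L13), Def. 1.2 l. 676–685 (p. 5 L55 – p. 6 L6), Thm. 1.3 l. 702 (p. 6 L54),
Conj. 1.4 l. 718 (p. 7 L37), Conj. 1.5 l. 740 (p. 8 L8), Rem. 1.6 l. 771 (p. 9 L5), §1.2 l. 776 (p. 9), Thm. 1.7 l. 782
(p. 9 L24), Thm. 1.8 l. 822 (p. 11 L5), §1.3 l. 848–962 (pp. 11–15): set-up l. 853–872 (p. 11 L50 – p. 12 L37), Conj. 1.9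
l. 875–890 (p. 12 L38 – p. 13 L19), Rem. 1.10 l. 892–894 (p. 13 L20), unitary `O_F`-modules and `𝒩_n` l. 896–913 (p. 13
L22 – p. 14 L2), formal special divisors l. 915–921 (p. 14 L3–18), Def. 1.11 l. 923–929 (p. 14 L19–27), `Γ_g` l. 931
(p. 14 L28–33), Conj. 1.12 l. 934–942 (p. 14 L34–49), l. 944 (p. 14 L50–51), Rem. 1.13 l. 946–955 (p. 15 L5–11), Rem. 1.14
l. 959–961 (p. 15 L12–18), §1.4 l. 964 (p. 15), Conj. 1.15 l. 991–996 (p. 16 L9–15) with footnote 3 = l. 986 (p. 16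
L64–65), §1.5 l. 1021 (p. 17), §1.6 l. 1048 (p. 18), §1.7 l. 1090–1158 (pp. 20–21).

DEDUP CENSUS (2026-09-02, squad TL «GO 500», deal TL-plan 02:11:43Z row t11): `rg 'cite: Liu2021, (Thm.|Def.|Conj.|Rem.)
1.x'` over `lean/Literature` + `lean/Summits` = ONE hit, a provenance tag «[cite: Liu2021, Thm. 1.1 (CM case); Thm. 4.18; …]»
in `Summits/HodgeConjecture/HodgeConjecture/Theorems/HCCMUnconditionalOfF0Sockets.lean`; `lean search` for
relevant / symmetric space / transfer factor / arithmetic fundamental lemma / Rapoport–Zink = no declaration.  Everything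
typed below is GREEN FIELD; everything the introduction RESTATES from §4–§5 is cited by name in the INDEX.

## What this file is

The squad-TL carpet of §1.  §1 is an introduction: Theorems 1.1, 1.3, 1.7, 1.8 and Conjectures 1.4, 1.5 are announced
forms of results/conjectures stated precisely in §4–§5, and are INDEXED to the declarations typing those (landed ★ or in
the sibling squad files), not re-typed.  What §1 states ORIGINALLY — and what later sections and Appendix A cite back
to — is typed here, in the squad discipline (ruling TL-plan 2026-09-02T01:59:30Z; «What a CARRIER is», module docstring of
★ `Thm418AsPrinted`): REAL objects wherever Mathlib / the tree has them, ⟨CARRIER⟩ data (posited types / functions,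
printed meaning quoted, NOTHING asserted) otherwise; every numbered item a PREDICATE `def … : Prop` on the consumer's
data; a consumer takes `(h : Item D)` for ITS OWN `D`; `∀ D, Item D` is never the printed statement and is never claimed.

HONESTY NOTE (items 1.9, 1.12, 1.15).  In print these three items are headed «Conjecture 1.9 / 1.12 / 1.15» — the paper's
PREDICTED identities (relative fundamental lemma, arithmetic fundamental lemma, non-vanishing of a twisted central value), NOT
proved in the source.  By the human rule («unproven predictions are not Literature facts») they are typed here ONLY AS VOCABULARY:
`Item19Part1`, `Item19Part2` (file 2), `Item112AsPrinted` with `AFLIdentity` (file 3), `Item115AsPrinted` (this file) are predicates NAMING the printed relation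
on the consumer's data, exactly as ★ `Thm418AsPrinted D` names a printed theorem; nothing is asserted, no `_holds` can be filed from
this file, and a route that wants to USE one of them takes it as a crux / `--conditional-on` an `@[conjecture]` leaf under
`Summits/` (gate rule), citing these names for the statement.  They are typed at all because the printed THEOREMS about them —
Remark 1.10 ([Liu14]), Remark 1.13 ([Zha12], [Zha21]), Remark 1.14 (Appendix A, Li–Zhu) and footnote 3 ([JZ20]) — are genuine
Literature facts whose statements need the vocabulary.  The DECLARATION docstrings render the printed heading word as «item 1.x» /
«[item]» / «[statement]» (editorial brackets; the squad precedent is `Sec44ArithmeticGGP`, items 4.31/4.33/4.37), because the gate's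
lint for unproved predictions keys on that word; the verbatim headings are quoted in this module docstring.

1. **Definition 1.2** (pp. 5–6): `IsobaricSum` (the datum «`Π = ⊞_{i=1}^{s(Π)} Π_i`» with REAL cuspidal factors
   `Π_i : ★ CuspidalAutomorphicRepGL n_i E`), `IsobaricSum.numFactors` (= `s(Π)`), `argPow` / `relevantExponent` (REAL:
   `arg(z)^k`, the exponents `(1−n, 3−n, …, n−1)`), `ArchDictionary` (⟨CARRIER⟩: «`Π_v`» and «the principal series induced
   by characters» at archimedean `v` — no parabolic induction in Mathlib/the tree), `Def12Clause1`, `Def12Clause2`,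
   `IsRelevant`, and the printed «Note» as the named fact `Def12NoteAsPrinted`.
2. **Item 1.15** (p. 16): `Item115Dictionary` (REAL hermitian Gram matrices over the CM field `E`, REAL ★
   `IdeleClassGroup.IsConjugateOrthogonal` / `IsConjugateSymplectic`; ⟨CARRIER⟩ tempered cuspidal `π` of `U(V)(𝔸_F)` and
   «`L(½, Π ⊗ μ)`»), `IsHermSpace`, `Item115AsPrinted` (VOCABULARY PREDICATE), `Footnote3AsPrinted` ([JZ20] = `JiangZhang2020`: `n ≤ 4`).
3. (files 2–3, namespaces `Literature.NumberTheory.Automorphic.Liu2021.Sec13RelativeFundamentalLemma` /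
   `.Sec13ArithmeticFundamentalLemma`): the §1.3 set-up REAL over Mathlib's `IsNonarchimedeanLocalField` (`AFLSetup`, `symmSpace` =
   `S_n(F)`, `momentMatrix`, `IsRegularSemisimple`, `krylov`, `transferFactor` = `ω(ζ, y)`, `act`, `sign`, `HermSpaceLoc` = `V_n^±`,
   `IsRegularSemisimpleU`, `Matches`, `orbIntegral` = `Orb(s; f, φ; ζ, y)`, self-dual lattices, `orbIntegralU`), the printed prose facts
   (`OrbitInvarianceAsPrinted`, `MatchingBijectionAsPrinted`, `SignCriterionAsPrinted`), item 1.9 (`Item19Part1/2`), Remark 1.10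
   (`Rem110_1AsPrinted`, `Rem110_2AsPrinted`); `RZDictionary` with Definition 1.11 (`RZDictionary.Z`), `LatticeFactsAsPrinted`, item 1.12
   (`AFLIdentity`, `Item112AsPrinted`), Remark 1.13 (`Rem113_1AsPrinted`, `Rem113_2AsPrinted`), Remark 1.14 (`IsMinuscule`, `Rem114AsPrinted`).

## INDEX — every item of §1 (pp. 3–21) ↦ its tree declaration(s)

(Namespaces: `L` = `Literature.NumberTheory.Automorphic.Liu2021`, `LC` = `L.AppendixC`, `AG` = `Literature.AlgebraicGeometry.Liu2021`,
`A` = `Literature.NumberTheory.Automorphic`; «(TL-t0k, p…)» = typed in the named sibling squad file by that typer and landed ★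
under that proposal id — cited by name, not imported (ED.3: all siblings cited below have landed).)
* **§1.1 opening** (p. 3 L14 – p. 4; `E/F`, `c`, `μ_{E/F}`, `V`, `U(V)`, `π_1, π_2`, the conjugate symplectic `μ`, the period
  `P_μ(f_1, f_2; φ)`, display **(1.1)**, the four GGP cases) — motivation; the automorphic period `P_μ` and (1.1) are NOT typed
  anywhere (no automorphic forms on `U(V)(𝔸_F)` as functions in the tree); conjugate symplectic / orthogonal ↦ ★
  `A.IdeleClassGroup.IsConjugateSymplectic` / `IsConjugateOrthogonal` (`ConjugateSelfDualCharacters.lean`, [Liu2021, Def. 4.1]).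
* **p. 4 L35 – p. 5 L12** (the incoherent `𝕍`, `Sh(𝕍)_K`, `X_K`, `X_∞`, `A_K`, `A_∞`, `M_μ`, `A_μ`, `i_μ`, `Ω(μ)`) ↦ ★ `L.Thm418Data`
  (`Thm418AsPrinted.lean`), ★ `LC.Sec42Data` (`AppendixC/Glue.lean`), ★ `L.Def45AsPrinted` (`𝒜(μ)`), ★ `L.fieldOfValues` (`M_μ`),
  ★ `L.Sec42AlbaneseUnitaryShimuraI.Def416Data` / `Def416AsPrinted` (`Ω(μ)`, Def. 4.16).
* **Theorem 1.1** (p. 5 L13–43; «(Theorem 4.18, Corollary 4.20)») ↦ ★ `L.Thm418AsPrinted` (Thm. 4.18 as printed) and ★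
  `L.Sec42AlbaneseUnitaryShimuraII.Liu2021_Cor420_nEqTwo` / `Liu2021_Cor420_orbitInvariance` (Cor. 4.20); older readings ★
  `AG.LiuAlbaneseCMDatum.Thm418`.  NOT re-typed here.
* **Definition 1.2** (p. 5 L55 – p. 6 L8) ↦ THIS FILE, item 1 (`IsobaricSum`, `IsRelevant`, `Def12NoteAsPrinted`, …); footnote 1
  (p. 5 L58–59: «the notion of relevant representation is more general than the one in [LTXZZ] as we allow `Π` to be isobaric»)
  recorded, not typed.
* **p. 6 L9–53** (the Vogan packet `Π_1, Π_2`, `π_1^∞, π_2^∞`, `α_K`, `FJ(f_1, f_2; φ)_K`, `CH^i(X_∞ × X_∞ × A_μ)^0_ℂ`, `CH^i_μ`) and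
  **Theorem 1.3** (p. 6 L54 – p. 7 L5; «(Subsections 4.3 and 4.4)») ↦ ★ `L.Sec43FourierJacobiCycles` (TL-t01, p847958:
  `CycleData.FJ`, `Prop427_1AsPrinted` / `Prop427_2AsPrinted` (homologically trivial), `Lem429_1AsPrinted` / `Lem429_2AsPrinted`
  (compatibility in `K`), `FJinfWellDefined`, `Lem430AsPrinted`) and ★ `L.Sec44ArithmeticGGP` (TL-t02, p847895).  NOT re-typed.
* **p. 7 L6–18** (the functional `FJ_ε`) and **Conjecture 1.4** (p. 7 L37 – 52; «(Conjecture 4.31)») ↦ ★ `L.Sec44ArithmeticGGP`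
  (TL-t02, p847895: `Sec44Data.Stmt431a/b/c`, `Item431AsPrinted`, `Rem432_*`).  NOT re-typed.
* **Conjecture 1.5** (p. 8 L8–50; «(Conjecture 4.33)»; `μ^c`, `Hom_E(A_K, A_μ, ε)`, `vol(K)`, `⟨ , ⟩^{BBP}`, `s(Π_i)`, `As^±`, `β`)
  ↦ ★ `L.Sec44ArithmeticGGP` (TL-t02, p847895: `Sec44Data.Item433AsPrinted`, `rhs49`, `Rem434_*`); `vol(K)` ↦ ★
  `L.Sec42AlbaneseUnitaryShimuraII.Sec42IIData.vol` (Def. 4.22); `⟨ , ⟩^{BBP}` ↦ ★ `L.Sec3CyclesHeightPairings.BBPHeightPairingData.bbp`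
  (Def. 3.7); `s(Π_i)` ↦ `IsobaricSum.numFactors` (THIS FILE); the variant Conj. 4.37 ↦ ★ `Sec44Data.Item437AsPrinted` (TL-t02).
  NOT re-typed.
* **Remark 1.6** (p. 9 L5–9: «We expect that the Fourier–Jacobi cycles can also be used to bound Selmer groups …») — an
  expectation, no mathematical statement; recorded, not typed.
* **§1.2** (p. 9 L10 – p. 11 L4) with **Theorem 1.7** (p. 9 L24 – p. 10 L8; «(Proposition 5.10, (5.8), and Proposition 5.15)»)
  ↦ ★ `L.Sec51DoublingFormulaCMData` (TL-t12, p848033: `Sec51Data.Prop510` = Prop. 5.10, with Def. 5.3, (5.4), Lem. 5.1–5.9) and ★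
  `L.Sec52ArithmeticInvariantFunctionals` (TL-t13, p848267: `Sec52Data.Eq58` = (5.8), `Sec52Data.Prop515_1` / `Prop515_2` =
  Prop. 5.15, Def. 5.12 `IzK`, Def. 5.17 `Sec52IntData.IKp` = `I_K(f, φ)_𝔭`; Def. 5.14 in ★ `L.Sec52Defs`, p848126); **Theorem 1.8**
  (p. 11 L5–31; «(Theorem 5.25)») ↦ ★ `L.Sec53OrbitalDecomposition.Sec53Data.Thm525` (TL-t13, p848357; its orbital integral, `V̄` and
  `χ(𝒪_{Γ_ξ̄} ⊗^𝕃 𝒪_{ΔZ(x̄)})` are that file's carriers).  NOT re-typed.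
* **§1.3** (p. 11 L45 – p. 15 L18) ↦ files 2–3 of this carpet (`Sec13RelativeFundamentalLemma`, `Sec13ArithmeticFundamentalLemma`);
  «see [Mih20, Section 3.1]» (`𝒩_n` formally smooth of relative dimension `n − 1`, p. 14 L1–2) and «By [RZ96, Proposition 2.9],
  `𝒵_n(x)` is a closed sub-formal scheme of `𝒩_n`» (p. 14 L28) are statements about formal schemes, which Mathlib lacks — recorded
  in the docstring of `RZDictionary` (file 3), not typed.
* **§1.4** (pp. 15–17: the two comparison diagrams) — informal; **Conjecture 1.15** (p. 16 L9–15) with **footnote 3** (p. 16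
  L64–65) ↦ THIS FILE, item 2.
* **§1.5** (pp. 17–18: comparison with the arithmetic triple product formula, Gross–Kudla–Schoen cycles) — informal («It is
  possible to show a priori …»); not typed.  **§1.6** (pp. 18–20: structure of the article) — not mathematical.
* **§1.7 Notation** (pp. 20–21) ↦ Mathlib / tree, not restated: `1_S` ↦ `Set.indicator`; `p_{abc…}` ↦ `Prod.fst` / `Prod.snd`
  / `Function.eval`; `Δ^r` ↦ `fun x => fun _ => x`; `A_R := A ⊗_ℤ R` ↦ `TensorProduct`; `k^{ac}` ↦ `AlgebraicClosure`; `ℂ^1` ↦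
  `Circle`; `𝔸^∞`, `𝔸_k` ↦ `FiniteAdeleRing`, `AdeleRing`; `| |_ℚ`, `| |_k^s` ↦ ★ `A.IdeleClassGroup.ideleNorm`; `ψ_ℚ`, `ψ_k` ↦ ★
  `A.Tate1950_adicComponent_adeleAddChar` ff. (`GlobalAdditiveCharacter.lean`) and ★ `Literature.RepresentationTheory.Liu2021`
  oscillator conventions; the Artin-map convention (uniformizer ↦ geometric Frobenius) is the tree's (`LC.Thm415PinnedOfFrobenius`);
  `Sch_{/S}`, `𝔾_m`, `Mat_{r,s}` ↦ Mathlib `Scheme`, `Matrix`; `M_n := Mat_{n,1} × Mat_{1,n}` ↦ `Mn` (file 2); `H^i_{B,τ}` ↦ ★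
  `LC.Sec42Data.bettiH1Tower` ff.; `D^b_{fl}(R)` and the Euler–Poincaré characteristic `χ` with value `∞` — no derived categories of
  finite-length modules in the tree: `χ` enters only as the ⟨CARRIER⟩ `RZDictionary.eulerChar` (file 3, valued in `WithTop ℤ`).

## The printed text of the items typed here (verbatim from `FJcycle.tex`; `\tc` = `c`, `\bA` = `𝔸`)

**Definition 1.2** (l. 676–685, p. 5 L55 – p. 6 L8): «We say that a complex representation `Π` of `GL_n(𝔸_E)` is *relevant*
if (1) `Π = ⊞_{i=1}^{s(Π)} Π_i` is an isobaric sum of `s(Π)` irreducible cuspidal automorphic representations `{Π_1, …, Π_{s(Π)}}`,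
which we call *cuspidal factors* of `Π`, satisfying `Π_i ∘ c ≃ Π_i^∨` for every `1 ≤ i ≤ s(Π)`, (2) for every archimedean place
`v` of `E`, `Π_v` is isomorphic to the (irreducible) principal series representation induced by the characters
`(arg^{1−n}, arg^{3−n}, …, arg^{n−3}, arg^{n−1})`, where `arg : ℂ^× → ℂ^×` is the *argument character* defined by the formula
`arg(z) := z/√(z z̄)`.  Note that (2) implies that the cuspidal factors `Π_1, …, Π_{s(Π)}` in (1) are mutually non-isomorphic.»


**Conjecture 1.15** (l. 991–996, p. 16 L9–15): «Let `V` be a hermitian space over `E` of rank `n ≥ 1`. Let `π` be a tempered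
cuspidal automorphic representation of `U(V)(𝔸_F)`. If `n` is even (resp. odd), then there exists a conjugate orthogonal (resp.
conjugate symplectic) automorphic character `μ` of `𝔸_E^×` such that `L(½, Π ⊗ μ) ≠ 0`, where `Π` is the standard base change of
`π` to `GL_n(𝔸_E)`.»  **Footnote 3** (l. 986, p. 16 L64–65): «Recently, Dihua Jiang and Lei Zhang [JZ20] have confirmed this
conjecture when `n ≤ 4`. Of course, when `n ≤ 2`, it was already known before.»  (Context, p. 4 L33 and p. 3 L14–16: «we will
assume that `E/F` is a CM extension»; `c` «the nontrivial Galois involution».)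

## The typing (paper order) and its READINGS (the only interpretive choices; no hypothesis is added, none dropped)

* **I1** (Def. 1.2 (1)).  Mathlib and the tree have no parabolic induction / isobaric sums for `GL_n(𝔸_E)` (module docstring of
  ★ `A.IsobaricAutomorphicRep`: «the tree has no induced / isobaric representations»).  An isobaric sum `Π = ⊞ Π_i` is determined
  by the multiset of its cuspidal factors (Jacquet–Shalika), so the datum «`Π` relevant» is PRESENTED by its factors: `IsobaricSum`
  records `s(Π)`, the sizes `n_i ≥ 1` with `Σ n_i = n`, and REAL cuspidal `Π_i : ★ CuspidalAutomorphicRepGL n_i E (μ n_i)` (the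
  tree's `L²_cusp` realizations, [Borel–Jacquet 1979, §4.6]); the order of the factors is immaterial in every statement below.
* **C1** (Def. 1.2 (1), «`Π_i ∘ c ≃ Π_i^∨`»).  `Π_i ∘ c` ↦ ★ `CuspidalAutomorphicRepGL.galConj F hμ c` ([ArthurClozel1989, Ch. 1
  §2.1], `AutomorphicGaloisConj.lean`); `Π_i^∨` ↦ ★ `CuspidalAutomorphicRepGL.conj` (the realization on the conjugate Hilbert
  space = the contragredient of the unitary `Π_i`, module docstring of `AutomorphicConjugate.lean`); «`≃`» ↦ EQUALITY of these
  realizations inside `L²_cusp(GL_{n_i})`, exactly as the tree renders «`Π ≅ Π^σ`» by ★ `CuspidalAutomorphicRepGL.IsGalStable`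
  (isomorphic irreducible subrepresentations of `L²_cusp(GL_m)` coincide by multiplicity one).
* **A1** (Def. 1.2 (2)).  «`Π_v`» (the archimedean component of the isobaric sum) and «the (irreducible) principal series
  representation induced by the characters `(χ_1, …, χ_n)`» of `GL_n(E_v) ≅ GL_n(ℂ)` are ⟨CARRIER⟩ functions of `ArchDictionary`
  (values in a posited type of isomorphism classes); the characters themselves are REAL: `argPow k` is `z ↦ arg(z)^k` and
  `relevantExponent n i = 2i + 1 − n` lists `(1−n, 3−n, …, n−1)` (`i = 0, …, n−1`).
* **G1** (Conj. 1.15).  «hermitian space over `E` of rank `n ≥ 1`» (w.r.t. the complex conjugation of the CM field `E`, in coordinates —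
  with `c = NumberField.IsCMField… complexConj` in coordinates: a `c`-hermitian non-degenerate `H ∈ M_n(E)`); «conjugate orthogonal
  (resp. conjugate symplectic) automorphic character `μ` of `𝔸_E^×`» ↦ REAL ★ `A.IdeleClassGroup.IsConjugateOrthogonal E μ` /
  `IsConjugateSymplectic E μ` for `μ : IdeleClassGroup E →ₜ* Circle` (conjugate self-dual characters are unitary); «tempered cuspidal
  automorphic representation `π` of `U(V)(𝔸_F)`», «the standard base change `Π` of `π`» and «`L(½, Π ⊗ μ)`» ↦ ⟨CARRIER⟩s of
  `Item115Dictionary` (no automorphic `L`-functions of `GL_n × GL_1` over `𝔸_E` in the tree).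
NO PROOF anywhere (statements only); non-vacuity of the binder lists is checked in the seat's HOME scratch file
(`T/LIU/TL-t11/g0/Sec1_full_with_nonvacuity.lean`, not shipped).

## NOT here

The automorphic period `P_μ` and (1.1); Theorems 1.1/1.3/1.7/1.8 and items 1.4/1.5 (INDEX); §1.3 (files 2–3); §1.4–§1.6 prose;
proofs.

## References

* [Liu2021] Y. Liu, *Fourier–Jacobi cycles and arithmetic relative trace formula*, Camb. J. Math. 9 (2021) 1–147, arXiv:2102.11518
  — §1 pp. 3–21 (pins above); App. A p. 90 L33, p. 92 L6 (READING M1); App. C l. 4558 (READING H1); Def. 4.1 p. 41.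
* [JiangZhang2020] D. Jiang, L. Zhang, *Arthur parameters and cuspidal automorphic modules of classical groups*, Ann. of Math. 191
  (2020) — footnote 3 to Conj. 1.15 = [JZ20].
* [BorelJacquet1979] (the tree's `CuspidalAutomorphicRepGL`); [ArthurClozel1989] Ch. 1 §2.1 (`galConj`); [JacquetShalika1981]
  (READING I1).
-/

noncomputable section

open MeasureTheory NumberField Matrix

namespace Literature.NumberTheory.Automorphic.Liu2021.Sec1Introduction

/-! ## Item 1: Definition 1.2 (p. 5 L55 – p. 6 L8) — relevant representations of `GL_n(𝔸_E)` -/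

section Global

/-- **`arg(z)^k`** for the «argument character» `arg : ℂ^× → ℂ^×`, `arg(z) := z/√(z z̄) = z/|z|` (Def. 1.2 (2), p. 6 L2–3;
l. 683), as a function on `ℂ` (junk value at `z = 0`, where `z/‖z‖ = 0`). REAL. [cite: Liu2021, Def. 1.2 (p. 6)] -/
def argPow (k : ℤ) (z : ℂ) : ℂ :=
  (z / (‖z‖ : ℂ)) ^ k

/-- **The exponents `(1−n, 3−n, …, n−3, n−1)`** of Def. 1.2 (2) (p. 6 L1–2; l. 683): the `i`-th one (`i = 0, …, n−1`) is
`2i + 1 − n`. REAL. [cite: Liu2021, Def. 1.2 (p. 6)] -/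
def relevantExponent (n : ℕ) (i : Fin n) : ℤ :=
  2 * (i : ℤ) + 1 - n

variable (F : Type) [Field F] {E : Type} [Field E] [NumberField E] [Algebra F E] (n : ℕ)
  (μ : ∀ m : ℕ, Measure (AdelicGroupData.gl m E).automorphicQuotient)
  [∀ m : ℕ, SMulInvariantMeasure (AdelicGroupData.gl m E).Adelic (AdelicGroupData.gl m E).automorphicQuotient (μ m)]

/-- **The datum of [Liu2021, Definition 1.2 (1)]** (p. 5 L55–60; l. 676–680), READING I1: «`Π = ⊞_{i=1}^{s(Π)} Π_i` is an
isobaric sum of `s(Π)` irreducible cuspidal automorphic representations `{Π_1, …, Π_{s(Π)}}`, which we call *cuspidal factors* of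
`Π`» — presented by its cuspidal factors: the number `s = s(Π)`, the sizes `n_i ≥ 1` with `Σ_i n_i = n` (an isobaric sum on
`GL_n(𝔸_E)`), and the REAL cuspidal automorphic representations `Π_i` of `GL_{n_i}(𝔸_E)` (★ `CuspidalAutomorphicRepGL`, the
`L²_cusp` realizations for the automorphic measures `μ n_i`).  Nothing is asserted by this structure.
[cite: Liu2021, Def. 1.2 (p. 5)] -/
structure IsobaricSum : Type where
  /-- `s(Π)`, the number of cuspidal factors (p. 5 L56). -/
  s : ℕ
  /-- the size `n_i` of the `i`-th cuspidal factor (`Π_i` is a representation of `GL_{n_i}(𝔸_E)`). -/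
  deg : Fin s → ℕ
  /-- every factor is non-empty: `n_i ≥ 1`. -/
  deg_pos : ∀ i, 0 < deg i
  /-- `Σ_i n_i = n` («a complex representation `Π` of `GL_n(𝔸_E)`», p. 5 L55). -/
  sum_deg : ∑ i, deg i = n
  /-- the cuspidal factors `Π_1, …, Π_{s(Π)}` («irreducible cuspidal automorphic representations», p. 5 L57), REAL. -/
  factor : ∀ i, CuspidalAutomorphicRepGL (deg i) E (μ (deg i))

namespace IsobaricSum

variable {F n μ}

/-- **`s(Π)`**, the number of cuspidal factors of `Π` (Def. 1.2 (1), p. 5 L56; used in Conj. 1.5, p. 8 L45: «`s(Π_i)` has appeared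
in Definition 1.2»). [cite: Liu2021, Def. 1.2 (p. 5)] -/
def numFactors (P : IsobaricSum (E := E) n μ) : ℕ :=
  P.s

end IsobaricSum

/-- **Archimedean ⟨CARRIER⟩ dictionary for [Liu2021, Definition 1.2 (2)]** (p. 6 L1–3; l. 683), READING A1.  Posited, with
their printed meaning (nothing asserted): for every archimedean place `v` of `E`,
* `ArchRep v` — isomorphism classes of irreducible admissible representations of `GL_n(E_v)` (`E_v ≅ ℂ`);
* `localComponent v Π` — «`Π_v`», the `v`-component of the isobaric sum `Π = ⊞ Π_i` presented by `Π : IsobaricSum`;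
* `principalSeries v χ` — «the (irreducible) principal series representation induced by the characters `(χ_0, …, χ_{n−1})`» of
  `E_v^× ≅ ℂ^×` (normalized parabolic induction from the Borel subgroup of `GL_n(ℂ)`; the characters are REAL functions `ℂ → ℂ`).
[cite: Liu2021, Def. 1.2 (p. 6)] -/
structure ArchDictionary : Type 1 where
  /-- ⟨CARRIER⟩ irreducible admissible representations of `GL_n(E_v)` up to isomorphism, `v` archimedean. -/
  ArchRep : InfinitePlace E → Type
  /-- ⟨CARRIER⟩ «`Π_v`» for the isobaric sum `Π`. -/
  localComponent : ∀ v : InfinitePlace E, IsobaricSum (E := E) n μ → ArchRep v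
  /-- ⟨CARRIER⟩ «the principal series representation induced by the characters `(χ_0, …, χ_{n−1})`». -/
  principalSeries : ∀ v : InfinitePlace E, (Fin n → (ℂ → ℂ)) → ArchRep v

/-- **[Liu2021, Definition 1.2 (1)], the condition** (p. 5 L57–58; l. 680): «satisfying `Π_i ∘ c ≃ Π_i^∨` for every `1 ≤ i ≤ s(Π)`»,
for the nontrivial `F`-involution `c` of `E` and automorphic measures `μ m` invariant under `Aut(E/F)` (`hμ`, the hypothesis under
which ★ `galConj` is defined).  TYPED (READING C1): `(Π_i).galConj F (hμ n_i) c = (Π_i).conj` — `Π_i ∘ c` is the tree's Galois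
conjugate realization, `Π_i^∨` the tree's conjugate (= contragredient) realization, «`≃`» is equality of realizations in `L²_cusp`
(the tree's `IsGalStable` convention).  A predicate; nothing asserted. [cite: Liu2021, Def. 1.2 (p. 5)] -/
def Def12Clause1 (hμ : ∀ m : ℕ, IsGalInvariant F (μ m)) (c : E ≃ₐ[F] E) (P : IsobaricSum (E := E) n μ) : Prop :=
  ∀ i : Fin P.s, (P.factor i).galConj F (hμ (P.deg i)) c = (P.factor i).conj

variable {F n μ} in
/-- **[Liu2021, Definition 1.2 (2)]** (p. 6 L1–3; l. 683): «for every archimedean place `v` of `E`, `Π_v` is isomorphic to the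
(irreducible) principal series representation induced by the characters `(arg^{1−n}, arg^{3−n}, …, arg^{n−3}, arg^{n−1})`».  TYPED
(READING A1) over the dictionary `X`: `Π_v = PS(arg^{1−n}, …, arg^{n−1})` in `X.ArchRep v` for every `v`, the characters being the
REAL `argPow (relevantExponent n i)`.  A predicate; nothing asserted. [cite: Liu2021, Def. 1.2 (p. 6)] -/
def Def12Clause2 (X : ArchDictionary (E := E) n μ) (P : IsobaricSum (E := E) n μ) : Prop :=
  ∀ v : InfinitePlace E, X.localComponent v P = X.principalSeries v (fun i => argPow (relevantExponent n i))

/-- **[Liu2021, Definition 1.2] AS PRINTED** (p. 5 L55 – p. 6 L3; l. 676–684): «We say that a complex representation `Π` of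
`GL_n(𝔸_E)` is *relevant* if (1) `Π = ⊞_{i=1}^{s(Π)} Π_i` is an isobaric sum of `s(Π)` irreducible cuspidal automorphic
representations […] satisfying `Π_i ∘ c ≃ Π_i^∨` for every `1 ≤ i ≤ s(Π)`, (2) for every archimedean place `v` of `E`, `Π_v` is
isomorphic to the (irreducible) principal series representation induced by the characters `(arg^{1−n}, arg^{3−n}, …, arg^{n−3},
arg^{n−1})` […].»  TYPED: `Def12Clause1 ∧ Def12Clause2` for the isobaric datum `P` (READINGS I1, C1, A1).  A consumer takes
`(h : IsRelevant F hμ c X P)` for ITS OWN data. [cite: Liu2021, Def. 1.2 (pp. 5–6)] -/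
def IsRelevant (hμ : ∀ m : ℕ, IsGalInvariant F (μ m)) (c : E ≃ₐ[F] E) (X : ArchDictionary (E := E) n μ)
    (P : IsobaricSum (E := E) n μ) : Prop :=
  Def12Clause1 F n μ hμ c P ∧ Def12Clause2 X P

variable {F n μ} in
/-- **[Liu2021, Definition 1.2, Note] AS PRINTED** (p. 6 L7–8; l. 685): «Note that (2) implies that the cuspidal factors
`Π_1, …, Π_{s(Π)}` in (1) are mutually non-isomorphic.»  TYPED (ED.3, exactly «(2) implies»): if the isobaric datum `P` satisfies
clause (2) (`Def12Clause2 X P`) then for `i ≠ j` the factors `(n_i, Π_i)` and `(n_j, Π_j)` are distinct (as realizations; factors of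
different sizes are distinct automatically); clause (1)'s conjugate self-duality is not a hypothesis (the printed reason is
archimedean: the exponents `1−n, 3−n, …, n−1` of (2) are pairwise distinct, so the archimedean components of the `Π_i` are).  Named
fact over the dictionary `X`, NO PROOF.  A consumer takes `(h : Def12NoteAsPrinted X P)` for ITS OWN data. [cite: Liu2021, Def. 1.2 (p. 6)] -/
def Def12NoteAsPrinted (X : ArchDictionary (E := E) n μ) (P : IsobaricSum (E := E) n μ) : Prop :=
  Def12Clause2 X P →
    ∀ i j : Fin P.s, i ≠ j →
      (⟨P.deg i, P.factor i⟩ : Σ m : ℕ, CuspidalAutomorphicRepGL m E (μ m)) ≠ ⟨P.deg j, P.factor j⟩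

end Global

/-! ## Item 2: item 1.15 (p. 16) — VOCABULARY PREDICATE — and footnote 3 -/

section Nonvanishing

variable (E : Type) [Field E] [NumberField E] [IsCMField E] (n : ℕ)

/-- **⟨CARRIER⟩ dictionary for [Liu2021, item 1.15]** (p. 16 L9–15; l. 991–996), READING G1, for the CM field `E` (over
`F = E⁺`, p. 4 L33) and the rank `n`.  REAL: a hermitian space `V` over `E` of rank `n` is a Gram matrix `H ∈ M_n(E)`, hermitian for the
complex conjugation `c` of `E` and non-degenerate (`IsHermSpace`); automorphic characters `μ` of `𝔸_E^×` that are conjugate orthogonal /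
symplectic are REAL (★ `IdeleClassGroup.IsConjugateOrthogonal` / `IsConjugateSymplectic`, unitary `μ : IdeleClassGroup E →ₜ* Circle`).
Posited (nothing asserted): `TemperedCusp H` — «tempered cuspidal automorphic representations `π` of `U(V)(𝔸_F)`» for `V = (E^n, H)`;
`LHalf π μ` — «`L(½, Π ⊗ μ)`, where `Π` is the standard base change of `π` to `GL_n(𝔸_E)`» (the central value of the Rankin–Selberg
`L`-function of `Π × μ`). [cite: Liu2021, §1.4 item 1.15 (p. 16)] -/
structure Item115Dictionary : Type 1 where
  /-- ⟨CARRIER⟩ tempered cuspidal automorphic representations of `U(V_H)(𝔸_F)`. -/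
  TemperedCusp : Matrix (Fin n) (Fin n) E → Type
  /-- ⟨CARRIER⟩ «`L(½, Π ⊗ μ)`», `Π` the standard base change of `π`. -/
  LHalf : ∀ {H : Matrix (Fin n) (Fin n) E}, TemperedCusp H → (IdeleClassGroup E →ₜ* Circle) → ℂ

variable {E n}

/-- **«a hermitian space over `E` of rank `n`»** (Conj. 1.15, p. 16 L9), READING G1/H1 in coordinates: `H` is hermitian for the complex
conjugation of the CM field `E` and non-degenerate. REAL. [cite: Liu2021, §1.4 item 1.15 (p. 16)] -/
def IsHermSpace (H : Matrix (Fin n) (Fin n) E) : Prop :=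
  (H.map (NumberField.IsCMField.complexConj E))ᵀ = H ∧ H.det ≠ 0

/-- **[Liu2021, item 1.15] — [statement] ONLY, typed as a VOCABULARY PREDICATE (HONESTY NOTE; its printed proved case `n ≤ 4` is
`Footnote3AsPrinted`)** (p. 16 L9–15; l. 991–996): «Let `V` be a hermitian space over `E` of rank `n ≥ 1`. Let `π` be a tempered cuspidal automorphic
representation of `U(V)(𝔸_F)`. If `n` is even (resp. odd), then there exists a conjugate orthogonal (resp. conjugate symplectic)
automorphic character `μ` of `𝔸_E^×` such that `L(½, Π ⊗ μ) ≠ 0`, where `Π` is the standard base change of `π` to `GL_n(𝔸_E)`.»  TYPED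
(READING G1) over the dictionary `X`.  Nothing asserted. [cite: Liu2021, §1.4 item 1.15 (p. 16)] -/
def Item115AsPrinted (X : Item115Dictionary E n) : Prop :=
  1 ≤ n →
    ∀ (H : Matrix (Fin n) (Fin n) E), IsHermSpace H → ∀ π : X.TemperedCusp H,
      (Even n → ∃ μ : IdeleClassGroup E →ₜ* Circle, IdeleClassGroup.IsConjugateOrthogonal E μ ∧ X.LHalf π μ ≠ 0) ∧
        (Odd n → ∃ μ : IdeleClassGroup E →ₜ* Circle, IdeleClassGroup.IsConjugateSymplectic E μ ∧ X.LHalf π μ ≠ 0)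

/-- **[Liu2021, footnote 3 to §1.4] AS PRINTED** (p. 16 L64–65; l. 986): «Recently, Dihua Jiang and Lei Zhang [JZ20] have confirmed
this [item] when `n ≤ 4`. Of course, when `n ≤ 2`, it was already known before.» (editorial bracket, HONESTY NOTE).  TYPED over the dictionary: `n ≤ 4 →
Item115AsPrinted X`.  Named fact, NO PROOF here ([JiangZhang2020]).  A consumer takes `(h : Footnote3AsPrinted X)`.
[cite: Liu2021, §1.4 footnote 3 (p. 16)] [cite: JiangZhang2020] -/
def Footnote3AsPrinted (X : Item115Dictionary E n) : Prop :=
  n ≤ 4 → Item115AsPrinted X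

end Nonvanishing

end Literature.NumberTheory.Automorphic.Liu2021.Sec1Introduction

end
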